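import Summits.NavierStokesRegularity.NavierStokesRegularity.Theorems.OddMorawetzOrderThreeIndefiniteGeneric
import Summits.NavierStokesRegularity.NavierStokesRegularity.Theorems.OddMorawetzOrderThreeIndefiniteMoments

/-!
# Route OddMorawetz / `OrderThreeIndefinite` — the Fourier side and the explicit value

Support file for item stmt-NavierStokesRegularity-1379: the Fourier-side evaluation of `orderThree_formula`.
* `𝓕[e^{-2|x|²}](ξ) = (π/2)^{3/2} e^{-π²|ξ|²/2}` (Mathlib `fourier_gaussian_innerProductSpace`);
* a polynomial Gaussian `ρ e^{-2r²}` whose polynomial is a combination of even-order conjugated derivatives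
  `D^{pairs ps} 1` (`Dⱼ = ∂ⱼ - 4xⱼ`, Hermite elements) has `𝓕[ρ e^{-2r²}] = hermVal · 𝓕[e^{-2r²}]`
  (`fourier_pgC_hermiteList`), so `Re ∫ 𝓕ρ_W conj 𝓕ρ_G /|ξ|² = (π/2)³ ∫ hermVal_W hermVal_G e^{-π²|ξ|²}/|ξ|²`;
* termwise integration of even monomial lists (`polyE`) against `e^{-4|x|²}` and `e^{-π²|ξ|²}/|ξ|²`
  (`OddMorawetzOrderThreeIndefiniteMoments`);
* `orderThree_value`: `Q_R(pgv 1 P)` as an explicit real number, given four polynomial identities of the data `P`.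
Everything is proved; no definitions.
-/

noncomputable section

open MeasureTheory SchwartzMap MvPolynomial
open scoped RealInnerProductSpace LineDeriv

-- the problem namespace `Summit.NavierStokesRegularity.NavierStokesRegularity` repeats the summit name by design (D-0017)
set_option linter.dupNamespace false

namespace Summit.NavierStokesRegularity.NavierStokesRegularity.Theorems.OddMorawetz

/-! ### Fourier side: the Gaussian, Hermite lists -/

section FourierSide
open FourierTransform Complex Real Literature.Analysis Literature.Analysis.FluidPDE
open scoped ComplexConjugate

/-- the Fourier transform of `e^{-2|x|²}` on `ℝ³`: `(π/2)^{3/2} e^{-π²|ξ|²/2}`, as a real number. -/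
theorem fourier_pgC_one (ξ : E3) :
    𝓕 (⇑(pgC 2 1)) ξ = (((π / 2) * Real.sqrt (π / 2) * Real.exp (-(π ^ 2 / 2) * ‖ξ‖ ^ 2) : ℝ) : ℂ) := by
  have hcoe : (⇑(pgC 2 1) : E3 → ℂ) = fun x => cexp (-(2 : ℂ) * (‖x‖ : ℂ) ^ 2) := by
    funext x
    rw [pgC_apply 2 two_pos, pg_def, pev_one, one_mul, Complex.ofReal_exp]
    push_cast
    ring_nf
  rw [hcoe, fourier_gaussian_innerProductSpace (by norm_num : (0 : ℝ) < (2 : ℂ).re)]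
  have hfin : (Module.finrank ℝ E3 : ℂ) = 3 := by simp
  rw [hfin]
  -- (π/2)^{3/2} as a real number
  have hπ2 : (0 : ℝ) ≤ π / 2 := by positivity
  have h1 : ((π : ℂ) / 2) ^ ((3 : ℂ) / 2) = (((π / 2) * Real.sqrt (π / 2) : ℝ) : ℂ) := by
    rw [show ((π : ℂ) / 2) = ((π / 2 : ℝ) : ℂ) by push_cast; ring, show ((3 : ℂ) / 2) = ((3 / 2 : ℝ) : ℂ) by
      push_cast; ring, ← Complex.ofReal_cpow hπ2]
    congr 1
    rw [show (3 / 2 : ℝ) = 1 + 1 / 2 by norm_num, Real.rpow_add_of_nonneg hπ2 (by norm_num) (by norm_num),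
      Real.rpow_one, Real.sqrt_eq_rpow]
  rw [h1, Complex.ofReal_mul, Complex.ofReal_mul, Complex.ofReal_exp]
  push_cast
  ring_nf

/-- `pairs [] = []`. -/
@[simp] theorem pairs_nil : pairs [] = [] := rfl
/-- `pairs (j :: ps) = j :: j :: pairs ps`. -/
@[simp] theorem pairs_cons (j : Fin 3) (ps : List (Fin 3)) : pairs (j :: ps) = j :: j :: pairs ps := rfl

/-- `hermVal [] ξ = 0`. -/
@[simp] theorem hermVal_nil (ξ : E3) : hermVal [] ξ = 0 := rfl
/-- Unfolding `hermVal` on a cons. -/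
@[simp] theorem hermVal_cons (dl : ℝ × List (Fin 3)) (L : List (ℝ × List (Fin 3))) (ξ : E3) :
    hermVal (dl :: L) ξ = dl.1 * (dl.2.map fun j => -(4 * π ^ 2 * ξ j ^ 2)).prod + hermVal L ξ := rfl

/-- `∏_{j ∈ pairs ps} (2πi ξⱼ) = ∏_{j ∈ ps} (-4π² ξⱼ²)` (as a real number). -/
theorem prod_pairs_eq (ps : List (Fin 3)) (ξ : E3) :
    ((pairs ps).map fun j => 2 * π * I * (ξ j : ℂ)).prod = (((ps.map fun j => -(4 * π ^ 2 * ξ j ^ 2)).prod : ℝ) : ℂ) := by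
  induction ps with
  | nil => simp
  | cons j ps ih =>
    rw [pairs_cons, List.map_cons, List.map_cons, List.prod_cons, List.prod_cons, ih, List.map_cons, List.prod_cons]
    push_cast
    ring_nf
    rw [I_sq]
    ring

/-- `pev` of a list sum. -/
theorem pev_listSum (L : List P3) (x : E3) : pev L.sum x = (L.map fun p => pev p x).sum := by
  induction L with
  | nil => simp
  | cons p L ih => simp [ih]

/-- **Fourier transform of a paired Hermite-list combination**: if `ρ(x) = ∑_{(d,ps)} d · (D^{pairs ps} 1)(x)` pointwise,
then `𝓕[ρ e^{-2r²}](ξ) = hermVal(ξ) · 𝓕[e^{-2r²}](ξ)`. -/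
theorem fourier_pgC_hermiteList (ρ : P3) (L : List (ℝ × List (Fin 3)))
    (hρ : ∀ x, pev ρ x = (L.map fun dl => dl.1 * pev (dgList 2 (pairs dl.2) 1) x).sum) (ξ : E3) :
    𝓕 (⇑(pgC 2 ρ)) ξ = ((hermVal L ξ : ℝ) : ℂ) * 𝓕 (⇑(pgC 2 1)) ξ := by
  -- replace `ρ` by the polynomial-level combination
  set ρ' : P3 := (L.map fun dl => dl.1 • dgList 2 (pairs dl.2) 1).sum with hρ'
  have hρρ' : pgC 2 ρ = pgC 2 ρ' := by
    ext x
    rw [pgC_apply 2 two_pos, pgC_apply 2 two_pos, pg_def, pg_def, hρ x, hρ', pev_listSum, List.map_map]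
    congr 3
    refine List.map_congr_left fun dl _ => ?_
    simp [pev_smul]
  rw [hρρ', hρ']
  clear hρρ' hρ' hρ
  induction L with
  | nil =>
    simp only [List.map_nil, List.sum_nil, hermVal_nil]
    have : (pgC 2 (0 : P3)) = 0 := by ext x; simp [pgC_apply 2 two_pos]
    rw [this]
    simp [Real.fourier_eq]
  | cons dl L ih =>
    simp only [List.map_cons, List.sum_cons, hermVal_cons]
    have hsplit : pgC 2 (dl.1 • dgList 2 (pairs dl.2) 1 + (L.map fun dl => dl.1 • dgList 2 (pairs dl.2) 1).sum) =
        dl.1 • iterLD (pairs dl.2) (pgC 2 1) +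
          pgC 2 ((L.map fun dl => dl.1 • dgList 2 (pairs dl.2) 1).sum) := by
      rw [iterLD_pgC 2 two_pos]
      ext x
      simp only [pgC_apply 2 two_pos, add_apply, smul_apply, pg_add, pg_smul, Complex.real_smul]
      push_cast
      rfl
    rw [hsplit, ← SchwartzMap.fourier_coe, FourierTransform.fourier_add, FourierTransform.fourier_smul,
      add_apply, smul_apply, fourier_iterLD_apply, prod_pairs_eq]
    simp only [SchwartzMap.fourier_coe] at ih ⊢
    rw [ih, Complex.real_smul]
    push_cast
    ring

/-- **From the complex Fourier-side pairing to a real Gaussian Riesz integral**: if the two transforms are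
real polynomial multiples of the Gaussian transform, `Re ∫ 𝓕ρ_W conj(𝓕ρ_G)/|ξ|² = (π/2)³ ∫ P_W P_G e^{-π²|ξ|²}/|ξ|²`. -/
theorem re_integral_fourier_pair (ρW ρG : P3) (PW PG : E3 → ℝ)
    (hW : ∀ ξ, 𝓕 (⇑(pgC 2 ρW)) ξ = ((PW ξ : ℝ) : ℂ) * 𝓕 (⇑(pgC 2 1)) ξ)
    (hG : ∀ ξ, 𝓕 (⇑(pgC 2 ρG)) ξ = ((PG ξ : ℝ) : ℂ) * 𝓕 (⇑(pgC 2 1)) ξ) :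
    RCLike.re (∫ ξ : E3, 𝓕 (⇑(pgC 2 ρW)) ξ * conj (𝓕 (⇑(pgC 2 ρG)) ξ) / ((‖ξ‖ ^ 2 : ℝ) : ℂ)) =
      (π / 2) ^ 3 * ∫ ξ : E3, PW ξ * PG ξ * Real.exp (-π ^ 2 * ‖ξ‖ ^ 2) / ‖ξ‖ ^ 2 := by
  have hpt : ∀ ξ : E3, 𝓕 (⇑(pgC 2 ρW)) ξ * conj (𝓕 (⇑(pgC 2 ρG)) ξ) / ((‖ξ‖ ^ 2 : ℝ) : ℂ) =
      (((π / 2) ^ 3 * (PW ξ * PG ξ * Real.exp (-π ^ 2 * ‖ξ‖ ^ 2) / ‖ξ‖ ^ 2) : ℝ) : ℂ) := by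
    intro ξ
    rw [hW, hG, fourier_pgC_one]
    set γ : ℝ := π / 2 * Real.sqrt (π / 2) * Real.exp (-(π ^ 2 / 2) * ‖ξ‖ ^ 2) with hγdef
    have hsq : Real.sqrt (π / 2) * Real.sqrt (π / 2) = π / 2 := Real.mul_self_sqrt (by positivity)
    have hexp : Real.exp (-(π ^ 2 / 2) * ‖ξ‖ ^ 2) * Real.exp (-(π ^ 2 / 2) * ‖ξ‖ ^ 2) =
        Real.exp (-π ^ 2 * ‖ξ‖ ^ 2) := by rw [← Real.exp_add]; ring_nf
    have hγ : γ * γ = (π / 2) ^ 3 * Real.exp (-π ^ 2 * ‖ξ‖ ^ 2) := by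
      calc γ * γ = (π / 2) ^ 2 * (Real.sqrt (π / 2) * Real.sqrt (π / 2)) *
            (Real.exp (-(π ^ 2 / 2) * ‖ξ‖ ^ 2) * Real.exp (-(π ^ 2 / 2) * ‖ξ‖ ^ 2)) := by rw [hγdef]; ring
        _ = _ := by rw [hsq, hexp]; ring
    have hc : ((PW ξ : ℝ) : ℂ) * (γ : ℂ) * conj (((PG ξ : ℝ) : ℂ) * (γ : ℂ)) / ((‖ξ‖ ^ 2 : ℝ) : ℂ) =
        ((PW ξ * γ * (PG ξ * γ) / ‖ξ‖ ^ 2 : ℝ) : ℂ) := by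
      simp only [map_mul, Complex.conj_ofReal]
      push_cast
      ring
    rw [hc]
    congr 1
    calc PW ξ * γ * (PG ξ * γ) / ‖ξ‖ ^ 2 = PW ξ * PG ξ * (γ * γ) / ‖ξ‖ ^ 2 := by ring
      _ = _ := by rw [hγ]; ring
  simp_rw [hpt]
  rw [integral_complex_ofReal]
  simp only [RCLike.re_to_complex, Complex.ofReal_re]
  exact integral_const_mul _ _

/-! ### List bookkeeping for explicit polynomial integrals -/

/-- `polyE [] x = 0`. -/
@[simp] theorem polyE_nil (x : E3) : polyE [] x = 0 := rfl
/-- Unfolding `polyE` on a cons. -/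
@[simp] theorem polyE_cons (t : ℝ × ℕ × ℕ × ℕ) (L : List (ℝ × ℕ × ℕ × ℕ)) (x : E3) :
    polyE (t :: L) x = t.1 * (x 0 ^ (2 * t.2.1) * x 1 ^ (2 * t.2.2.1) * x 2 ^ (2 * t.2.2.2)) + polyE L x := rfl

/-- **termwise integration** of an even polynomial against a weight -/
theorem integral_polyE_mul (w : E3 → ℝ)
    (hw : ∀ a b c : ℕ, Integrable (fun x : E3 => x 0 ^ (2 * a) * x 1 ^ (2 * b) * x 2 ^ (2 * c) * w x))
    (L : List (ℝ × ℕ × ℕ × ℕ)) :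
    ∫ x, polyE L x * w x =
      (L.map fun t => t.1 * ∫ x : E3, x 0 ^ (2 * t.2.1) * x 1 ^ (2 * t.2.2.1) * x 2 ^ (2 * t.2.2.2) * w x).sum := by
  induction L with
  | nil => simp
  | cons t L ih =>
    simp only [polyE_cons, List.map_cons, List.sum_cons, add_mul]
    have hi1 : Integrable (fun x => t.1 * (x 0 ^ (2 * t.2.1) * x 1 ^ (2 * t.2.2.1) * x 2 ^ (2 * t.2.2.2)) * w x) := by
      have := (hw t.2.1 t.2.2.1 t.2.2.2).const_mul t.1
      refine this.congr (Filter.Eventually.of_forall fun x => ?_)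
      ring
    have hi2 : Integrable (fun x => polyE L x * w x) := by
      clear ih
      induction L with
      | nil => simp
      | cons t' L' ih' =>
        simp only [polyE_cons, add_mul]
        refine Integrable.add ?_ ih'
        have := (hw t'.2.1 t'.2.2.1 t'.2.2.2).const_mul t'.1
        exact this.congr (Filter.Eventually.of_forall fun x => by ring)
    rw [integral_add hi1 hi2, ih, ← integral_const_mul]
    congr 1
    exact integral_congr_ae (Filter.Eventually.of_forall fun x => by ring)

/-- local Gaussian weight `e^{-4r²}`: the monomial values -/
theorem integral_monomial_gauss_four_even (a b c : ℕ) :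
    ∫ x : E3, x 0 ^ (2 * a) * x 1 ^ (2 * b) * x 2 ^ (2 * c) * Real.exp (-4 * ‖x‖ ^ 2) =
      ((2 * a - 1).doubleFactorial * (2 * b - 1).doubleFactorial * (2 * c - 1).doubleFactorial : ℝ) *
        (π * Real.sqrt π / (8 ^ (a + b + c) * 8)) := by
  rw [integral_monomial_gauss, integral_pow_even_mul_exp_neg_mul_sq (by norm_num : (0:ℝ) < 4),
    integral_pow_even_mul_exp_neg_mul_sq (by norm_num : (0:ℝ) < 4),
    integral_pow_even_mul_exp_neg_mul_sq (by norm_num : (0:ℝ) < 4)]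
  have hs : Real.sqrt (π / 4) = Real.sqrt π / 2 := by
    rw [Real.sqrt_div' _ (by norm_num : (0:ℝ) ≤ 4), show (4 : ℝ) = 2 ^ 2 by norm_num,
      Real.sqrt_sq (by norm_num : (0:ℝ) ≤ 2)]
  rw [hs]
  have hπ : Real.sqrt π ^ 2 = π := Real.sq_sqrt pi_pos.le
  rw [show (2 : ℝ) * 4 = 8 by norm_num, pow_add]
  field_simp
  rw [hπ]
  ring

/-- the weight on the Fourier side -/
theorem integrable_monomial_riesz_weight (a b c : ℕ) :
    Integrable (fun ξ : E3 => ξ 0 ^ (2 * a) * ξ 1 ^ (2 * b) * ξ 2 ^ (2 * c) *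
      (Real.exp (-π ^ 2 * ‖ξ‖ ^ 2) / ‖ξ‖ ^ 2)) := by
  refine (integrable_monomial_gauss_div_normSq (by positivity : 0 < π ^ 2) a b c).congr
    (Filter.Eventually.of_forall fun ξ => ?_)
  ring

/-- Even monomials are integrable against `e^{-4|x|²}`. -/
theorem integrable_monomial_gauss_four (a b c : ℕ) :
    Integrable (fun x : E3 => x 0 ^ (2 * a) * x 1 ^ (2 * b) * x 2 ^ (2 * c) * Real.exp (-4 * ‖x‖ ^ 2)) :=
  integrable_monomial_gauss (by norm_num) _ _ _

/-- **The order-3 Euler derivative of an explicit polynomial-Gaussian field as an explicit number**, given the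
polynomial bookkeeping of the field (Hermite expansions of the two divergences, monomial expansions of `⟪W,G⟫`
and of the Fourier-side product). -/
theorem orderThree_value (P : Fin 3 → P3) (LW LG : List (ℝ × List (Fin 3))) (Mloc Mfour : List (ℝ × ℕ × ℕ × ℕ))
    (hW : ∀ x, pev (rhoWP P) x = (LW.map fun dl => dl.1 * pev (dgList 2 (pairs dl.2) 1) x).sum)
    (hG : ∀ x, pev (rhoGP P) x = (LG.map fun dl => dl.1 * pev (dgList 2 (pairs dl.2) 1) x).sum)
    (hloc : ∀ x, pev (WGP P) x = polyE Mloc x)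
    (hfour : ∀ ξ, hermVal LW ξ * hermVal LG ξ = polyE Mfour ξ) :
    -∫ x, (⟪curl (eulerBilinear (pgv 1 P) (pgv 1 P)) x, fderiv ℝ (pgv 1 P) x (curl (pgv 1 P) x)⟫ +
        ⟪curl (pgv 1 P) x, fderiv ℝ (eulerBilinear (pgv 1 P) (pgv 1 P)) x (curl (pgv 1 P) x)⟫ +
          ⟪curl (pgv 1 P) x, fderiv ℝ (pgv 1 P) x (curl (eulerBilinear (pgv 1 P) (pgv 1 P)) x)⟫) =
      -2⁻¹ * ((Mloc.map fun t => t.1 *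
          (((2 * t.2.1 - 1).doubleFactorial * (2 * t.2.2.1 - 1).doubleFactorial * (2 * t.2.2.2 - 1).doubleFactorial : ℝ) *
            (π * Real.sqrt π / (8 ^ (t.2.1 + t.2.2.1 + t.2.2.2) * 8)))).sum -
        ((2 * π) ^ 2)⁻¹ * ((π / 2) ^ 3 * (Mfour.map fun t => t.1 *
          (((2 * t.2.1 - 1).doubleFactorial * (2 * t.2.2.1 - 1).doubleFactorial * (2 * t.2.2.2 - 1).doubleFactorial : ℝ) *
            (2 / ((2 * (t.2.1 + t.2.2.1 + t.2.2.2 : ℕ) + 1) * 2 ^ (t.2.1 + t.2.2.1 + t.2.2.2))) *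
              (Real.sqrt π / π ^ (2 * (t.2.1 + t.2.2.1 + t.2.2.2))))).sum)) := by
  rw [orderThree_formula]
  have hW' := fourier_pgC_hermiteList (rhoWP P) LW hW
  have hG' := fourier_pgC_hermiteList (rhoGP P) LG hG
  rw [re_integral_fourier_pair (rhoWP P) (rhoGP P) (hermVal LW) (hermVal LG) hW' hG']
  congr 2
  · -- the local integral
    have h1 : (fun x => pg 4 (WGP P) x) = fun x => polyE Mloc x * Real.exp (-4 * ‖x‖ ^ 2) := by
      funext x; rw [pg_def, hloc x]; norm_num
    rw [show (∫ x, pg 4 (WGP P) x) = ∫ x, polyE Mloc x * Real.exp (-4 * ‖x‖ ^ 2) from by rw [← h1],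
      integral_polyE_mul _ integrable_monomial_gauss_four]
    congr 1
    refine List.map_congr_left fun t _ => ?_
    rw [integral_monomial_gauss_four_even]
  · congr 2
    have h2 : (fun ξ : E3 => hermVal LW ξ * hermVal LG ξ * Real.exp (-π ^ 2 * ‖ξ‖ ^ 2) / ‖ξ‖ ^ 2) =
        fun ξ => polyE Mfour ξ * (Real.exp (-π ^ 2 * ‖ξ‖ ^ 2) / ‖ξ‖ ^ 2) := by
      funext ξ; rw [hfour ξ]; ring
    rw [h2, integral_polyE_mul _ integrable_monomial_riesz_weight]
    congr 1
    refine List.map_congr_left fun t _ => ?_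
    rw [← integral_monomial_gauss_div_normSq_pi]
    congr 1
    exact integral_congr_ae (Filter.Eventually.of_forall fun ξ => by ring)

end FourierSide
end Summit.NavierStokesRegularity.NavierStokesRegularity.Theorems.OddMorawetz
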